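import Literature.Geometry.Manifold.ChartConvexToSmooth
import Literature.Geometry.Manifold.DeRhamDisjointUnion
import Literature.Topology.OpenBootstrap
import Literature.NumberTheory.Transcendental.DeRhamTheorem
import HarnessLib

/-!
# De Rham's theorem on every open set: the bootstrap

The inductive heart of the integration proof of **de Rham's theorem** (de Rham 1931), following
G. E. Bredon, *Topology and Geometry* (1993), Thm. V.9.5 with the bootstrap lemma of §V.9
(`Literature.Topology.open_bootstrap`), and Lee (2013), Thm. 18.14.

For an open subset `U` of a `C^∞` manifold `M` (Hausdorff, second countable, finite-dimensional
boundaryless model) let `Good U` say that both comparison maps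

* the de Rham homomorphism `Ψ_U : Ω•(U) ⟶ Hom(Δ•^{sm}(U), ℝ)` (`deRhamMap`), and
* the restriction `Hom(Δ•(U), ℝ) ⟶ Hom(Δ•^{sm}(U), ℝ)` (`smoothSubsetCochains.toSmooth`)

induce isomorphisms on cohomology in all degrees. We prove `Good ∅`, `Good` of chart-convex
sets (the Poincaré lemmas: `localDeRhamComplex.isZero_homology_chartSet`,
`isIso_homologyMap_toSmooth_chartSet`, and degree `0` by hand), Mayer–Vietoris
(`isIso_homologyMap_deRhamMap_union`, `isIso_homologyMap_toSmooth_union`) and disjoint unions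
(`…_iUnion`), and conclude by two applications of the bootstrap lemma — first for open subsets
of one chart, then for all open sets — that **every open set is good** (`good_of_isOpen`), in
particular `M` itself (`good_univ`).

## References

* G. E. Bredon, *Topology and Geometry*, GTM 139 (1993), §V.9, Thm. V.9.5.
* J. M. Lee, *Introduction to Smooth Manifolds*, 2nd ed. (2013), Thm. 18.14.
-/

noncomputable section

-- see "Implementation notes" in `…SingularHomology.SingularChainsConcrete`
set_option backward.isDefEq.respectTransparency false

open scoped Manifold ContDiff Topology
open CategoryTheory Limits Set Literature.AlgebraicTopology.SingularHomology Literature.Geometry.Kaehler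

universe u

namespace Literature.Geometry.Manifold

variable {E : Type u} [NormedAddCommGroup E] [NormedSpace ℝ E]
  {H : Type u} [TopologicalSpace H] (I : ModelWithCorners ℝ E H)
  {M : Type u} [TopologicalSpace M] [ChartedSpace H M] [IsManifold I ∞ M]

/-- **`Good U`**: the de Rham homomorphism of `U` and the restriction from all to smooth singular
cochains of `U` are isomorphisms on cohomology in every degree (the statement bootstrapped in
Bredon (1993), proof of Thm. V.9.5). [cite: Bredon1993, Thm. V.9.5] -/
def Good (U : Set M) : Prop :=
  ∃ hU : IsOpen U, (∀ q, IsIso (HomologicalComplex.homologyMap (deRhamMap I hU) q)) ∧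
    ∀ q, IsIso (HomologicalComplex.homologyMap (smoothSubsetCochains.toSmooth I ℝ realCoeff.{u} U) q)

variable {I}

/-- A good set is open. [folklore] -/
theorem Good.isOpen {U : Set M} (h : Good I U) : IsOpen U := h.1

/-- The de Rham homomorphism of a good set is an isomorphism on cohomology. [folklore] -/
theorem Good.isIso_deRhamMap {U : Set M} (h : Good I U) (hU : IsOpen U) (q : ℕ) :
    IsIso (HomologicalComplex.homologyMap (deRhamMap I hU) q) :=
  h.2.1 q

/-- Restriction to smooth chains on a good set is an isomorphism on cohomology. [folklore] -/
theorem Good.isIso_toSmooth {U : Set M} (h : Good I U) (q : ℕ) :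
    IsIso (HomologicalComplex.homologyMap (smoothSubsetCochains.toSmooth I ℝ realCoeff.{u} U) q) :=
  h.2.2 q

/-! ### The empty set -/

section Empty

omit [IsManifold I ∞ M] in
/-- There are no chains in `∅` (a simplex has nonempty image). [folklore] -/
theorem eq_zero_of_mem_chainsIn_empty {R : Type} [CommRing R] {n : ℕ} {x : CChain R M n}
    (hx : x ∈ chainsIn R R M (∅ : Set M) n) : x = 0 := by
  by_contra h
  obtain ⟨σ, hσ⟩ := Finsupp.support_nonempty_iff.2 h
  obtain ⟨y, hy⟩ := σ.range_nonempty
  exact (mem_chainsIn_iff R R x).1 hx σ hσ hy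

omit [IsManifold I ∞ M] in
/-- Cochains on a subcomplex of the chains in `∅` have zero cohomology. [folklore] -/
theorem isZero_homology_dualObj_of_le_chainsIn_empty {R : Type} [CommRing R] (N : ModuleCat.{u} R)
    (S : Subcomplex (csingularChainComplex R R M)) (hS : ∀ n, S n ≤ chainsIn R R M (∅ : Set M) n) (q : ℕ) :
    IsZero ((dualObj R N S.toComplex).homology q) := by
  rw [isZero_homology_iff]
  intro z _
  refine ⟨0, ?_⟩
  rw [map_zero]
  refine (ModuleCat.hom_ext (LinearMap.ext fun x ↦ ?_)).symm
  have hx : x = 0 := Subtype.ext (eq_zero_of_mem_chainsIn_empty (hS q x.2))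
  rw [hx, map_zero, map_zero]

/-- Forms on `∅` (vanishing off `∅`) have zero cohomology. [folklore] -/
theorem isZero_homology_localDeRhamComplex_empty (q : ℕ) :
    IsZero ((localDeRhamComplex I ℝ (isOpen_empty : IsOpen (∅ : Set M))).homology q) := by
  rw [isZero_homology_iff]
  intro z _
  refine ⟨0, ?_⟩
  rw [map_zero]
  refine (Subtype.ext (funext fun x ↦ ?_)).symm
  exact z.2.2 x (notMem_empty x)

/-- **`Good ∅`.** [folklore] -/
theorem good_empty : Good I (∅ : Set M) :=
  ⟨isOpen_empty,
    fun q ↦ isIso_of_isZero (isZero_homology_localDeRhamComplex_empty q)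
      (isZero_homology_dualObj_of_le_chainsIn_empty realCoeff _ (fun _ ↦ inf_le_right) q) _,
    fun q ↦ isIso_of_isZero (isZero_homology_dualObj_of_le_chainsIn_empty realCoeff _ (fun _ ↦ le_rfl) q)
      (isZero_homology_dualObj_of_le_chainsIn_empty realCoeff _ (fun _ ↦ inf_le_right) q) _⟩

end Empty

/-! ### Chart-convex sets: degree `0` of the de Rham homomorphism -/

section ChartSet

variable {p : M} {C : Set E} {c : E}

/-- The value of the de Rham homomorphism on a `0`-simplex: `(Ψ η)(σ) = η(σ(pt))`. [folklore] -/
theorem deRhamMap_cochainVal_single_zero {U : Set M} (hU : IsOpen U) (η : (localDeRhamComplex I ℝ hU).X 0)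
    (σ : SingularSimplex M 0) (hσ : Finsupp.single σ (1 : ℝ) ∈ smoothChainsInSub I ℝ ℝ M U 0) :
    cochainVal ((deRhamMap I hU).f 0 η) ⟨Finsupp.single σ 1, hσ⟩ =
      (η.1 : MForm I M ℝ 0) (Literature.AlgebraicTopology.SingularHomology.SingularSimplex.toContinuousMap σ default)
        Fin.elim0 := by
  rw [deRhamMap_cochainVal]
  change integrationFunctional (η.1 : MForm I M ℝ 0) (Finsupp.single σ 1) = _
  rw [integrationFunctional_single, one_mul, SingularSimplex.formIntegral_eq_of_zero]

omit [IsManifold I ∞ M] in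
/-- A `0`-form vanishes at a point where its value on the empty tuple vanishes. [folklore] -/
theorem MForm.apply_eq_zero_of_elim0 {η : MForm I M ℝ 0} {x : M} (h : η x Fin.elim0 = 0) : η x = 0 := by
  ext v
  rw [show v = Fin.elim0 from Subsingleton.elim _ _, h]
  rfl

/-- The point of a `0`-simplex lies in its image. [folklore] -/
theorem SingularSimplex.apply_default_mem_range (σ : SingularSimplex M 0) :
    Literature.AlgebraicTopology.SingularHomology.SingularSimplex.toContinuousMap σ default ∈ σ.range :=
  Set.mem_range_self _

variable [I.Boundaryless] [FiniteDimensional ℝ E]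

omit [I.Boundaryless] [FiniteDimensional ℝ E] in
/-- **The de Rham homomorphism of an open set is injective on `H⁰`**: a `0`-form on `U` whose
integrals over the points of `U` vanish is zero. [cite: Bredon1993, Thm. V.9.5] -/
theorem injective_homologyMap_deRhamMap_zero {U : Set M} (hU : IsOpen U) :
    Function.Injective (HomologicalComplex.homologyMap (deRhamMap I hU) 0) := by
  refine (homologyMap_injective_iff _).2 fun z _ hz ↦ ?_
  rw [exists_d_prev_eq_iff symm_down_prev_zero] at hz ⊢
  obtain ⟨w, hw⟩ := hz
  rw [d_prev_zero_apply] at hw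
  refine ⟨0, ?_⟩
  rw [d_prev_zero_apply]
  symm
  apply Subtype.ext
  funext x
  change (z.1 : MForm I M ℝ 0) x = (0 : MForm I M ℝ 0) x
  rw [Pi.zero_apply]
  by_cases hx : x ∈ U
  · -- the point `x` as a smooth `0`-simplex in `U`
    have hσ : Finsupp.single (SingularSimplex.constAt x 0) (1 : ℝ) ∈ smoothChainsInSub I ℝ ℝ M U 0 :=
      single_mem_smoothChainsInSub (isSmooth_constAt x 0) (by
        rw [SingularSimplex.range_constAt]; exact singleton_subset_iff.2 hx) 1
    have key := congrArg (fun ψ ↦ cochainVal ψ ⟨_, hσ⟩) hw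
    simp only at key
    rw [deRhamMap_cochainVal_single_zero, SingularSimplex.toContinuousMap_constAt_apply] at key
    exact MForm.apply_eq_zero_of_elim0 key.symm
  · exact z.2.2 x hx

omit [IsManifold I ∞ M] [I.Boundaryless] [FiniteDimensional ℝ E] in
/-- The restriction to `U` of a constant `0`-form is a form on `U`. [folklore] -/
theorem const_restr_mem_smoothFormsOn {U : Set M} (hU : IsOpen U) (a : ℝ) :
    (MForm.const I M a).restr U ∈ smoothFormsOn I ℝ U 0 :=
  ⟨fun x hx ↦ (MForm.smoothAt_restr_iff hU _ hx).2
      ((Literature.NumberTheory.Transcendental.isSmoothForm_const (I := I) (M := M) a) x),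
    fun _ hx ↦ MForm.restr_apply_of_notMem _ hx⟩

omit [I.Boundaryless] [FiniteDimensional ℝ E] in
/-- The restriction to `U` of a constant `0`-form is closed on `U`. [folklore] -/
theorem localD_const_restr {U : Set M} (hU : IsOpen U) (a : ℝ) :
    localD I ℝ 0 hU ⟨(MForm.const I M a).restr U, const_restr_mem_smoothFormsOn hU a⟩ = 0 := by
  apply Subtype.ext
  rw [coe_localD]
  funext x
  change ((mextDeriv ((MForm.const I M a).restr U)).restr U) x = (0 : MForm I M ℝ 1) x
  by_cases hx : x ∈ U
  · rw [MForm.restr_apply_of_mem _ hx, mextDeriv_restr_apply hU _ hx,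
      Literature.NumberTheory.Transcendental.mextDeriv_const]
  · rw [MForm.restr_apply_of_notMem _ hx, Pi.zero_apply]

omit [I.Boundaryless] [FiniteDimensional ℝ E] in
/-- **The de Rham homomorphism of a chart-convex set is surjective on `H⁰`**: a smooth
`0`-cocycle is constant on points (`cochainHom_zero_cocycle_apply_single`), hence the image of a
constant function. [cite: Bredon1993, Thm. V.9.5] -/
theorem surjective_homologyMap_deRhamMap_chartSet_zero (hC : IsOpen C) (hCc : Convex ℝ C)
    (hCT : C ⊆ (extChartAt I p).target) (hc : c ∈ C) :
    Function.Surjective (HomologicalComplex.homologyMap (deRhamMap I (isOpen_chartSet I p hC)) 0) := by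
  set U := chartSet I p C with hUdef
  have hU : IsOpen U := isOpen_chartSet I p hC
  refine (homologyMap_surjective_iff _).2 fun ψ hψ ↦ ?_
  rw [d_next_eq_zero_iff ((ComplexShape.down ℕ).symm.next_eq' (rfl : 0 + 1 = 1))] at hψ
  -- the value of `ψ` on points
  have hσ₀ := single_constAt_mem_smoothChainsInSub (I := I) hCT hc ℝ 0
  set r : ℝ := cochainVal ψ ⟨_, hσ₀⟩ with hr
  have hconst : ∀ (σ : SingularSimplex M 0) (hσ : Finsupp.single σ (1 : ℝ) ∈ smoothChainsInSub I ℝ ℝ M U 0),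
      cochainVal ψ ⟨_, hσ⟩ = r := fun σ hσ ↦
    congrArg ULift.down (cochainHom_zero_cocycle_apply_single hCc hCT hc realCoeff
      (smoothChainsInSub I ℝ ℝ M U) (fun _ ↦ inf_le_right)
      (fun _ _ hx ↦ prismOp_mem_smoothChainsInSub hCc hCT hc ℝ ℝ hx)
      (fun n ↦ single_constAt_mem_smoothChainsInSub hCT hc ℝ n) ψ hψ hσ hσ₀)
  -- the constant `0`-form `r` on `U`
  let y : (localDeRhamComplex I ℝ hU).X 0 := ⟨(MForm.const I M r).restr U, const_restr_mem_smoothFormsOn hU r⟩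
  refine ⟨y, ?_, 0, ?_⟩
  · rw [d_next_eq_zero_iff ((ComplexShape.down ℕ).symm.next_eq' (rfl : 0 + 1 = 1)), localDeRhamComplex_d]
    exact localD_const_restr hU r
  · rw [map_zero, eq_comm, sub_eq_zero]
    -- compare on elementary smooth `0`-chains in `U`
    refine ModuleCat.hom_ext (LinearMap.ext fun x ↦ ?_)
    obtain ⟨cx, hcx⟩ := x
    change CChain ℝ M 0 at cx
    have hST : ∀ x : CChain ℝ M 0, x ∈ smoothChainsInSub I ℝ ℝ M U 0 → ∀ σ ∈ x.support,
        Finsupp.single σ (x σ) ∈ smoothChainsInSub I ℝ ℝ M U 0 := fun x hx σ hσ ↦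
      single_mem_smoothChainsInSub ((mem_smoothChains_iff x).1 hx.1 σ hσ) ((mem_chainsIn_iff ℝ ℝ x).1 hx.2 σ hσ) _
    rw [subcomplex_eq_sum_single (smoothChainsInSub I ℝ ℝ M U) hST cx hcx, map_sum, map_sum]
    refine Finset.sum_congr rfl fun τ _ ↦ ?_
    have hτU : τ.1.range ⊆ U := (mem_chainsIn_iff ℝ ℝ cx).1 hcx.2 τ.1 τ.2
    have h1 : Finsupp.single τ.1 (1 : ℝ) ∈ smoothChainsInSub I ℝ ℝ M U 0 :=
      single_mem_smoothChainsInSub ((mem_smoothChains_iff cx).1 hcx.1 τ.1 τ.2) hτU 1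
    rw [subcomplex_single_eq_smul _ (cx τ.1) h1, map_smul, map_smul]
    congr 1
    apply ULift.ext
    change cochainVal ψ ⟨_, h1⟩ = cochainVal ((deRhamMap I hU).f 0 y) ⟨_, h1⟩
    rw [hconst τ.1 h1, deRhamMap_cochainVal_single_zero]
    change r = ((MForm.const I M r).restr U)
      (Literature.AlgebraicTopology.SingularHomology.SingularSimplex.toContinuousMap τ.1 default) Fin.elim0
    rw [MForm.restr_apply_of_mem _ (hτU (SingularSimplex.apply_default_mem_range τ.1))]
    rfl

/-- **`Good` of a chart-convex set** `chartSet I p C`, `C` open convex in the target of the chart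
at `p` and nonempty: the Poincaré lemma for forms (`localDeRhamComplex.isZero_homology_chartSet`),
the cone construction for (smooth) singular cochains (`isIso_homologyMap_toSmooth_chartSet`,
`isZero_homology_smoothSubsetCochains_chartSet`) and the degree-`0` computations above
(Bredon (1993), Lemma V.9.2/V.9.3 feeding Thm. V.9.5, property (1)). [cite: Bredon1993, Thm. V.9.5] -/
theorem good_chartSet (hC : IsOpen C) (hCc : Convex ℝ C) (hCT : C ⊆ (extChartAt I p).target) (hc : c ∈ C) :
    Good I (chartSet I p C) := by
  refine ⟨isOpen_chartSet I p hC, fun q ↦ ?_, fun q ↦ isIso_homologyMap_toSmooth_chartSet hCc hCT hc realCoeff q⟩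
  cases q with
  | zero =>
    exact (ConcreteCategory.isIso_iff_bijective _).2
      ⟨injective_homologyMap_deRhamMap_zero _, surjective_homologyMap_deRhamMap_chartSet_zero hC hCc hCT hc⟩
  | succ q =>
    exact isIso_of_isZero (localDeRhamComplex.isZero_homology_chartSet p hC hCc hCT q)
      (isZero_homology_smoothSubsetCochains_chartSet hCc hCT hc realCoeff q) _

end ChartSet

/-! ### Mayer–Vietoris and disjoint unions -/

section Operations

variable [FiniteDimensional ℝ E] [T2Space M] [SecondCountableTopology M]

/-- **`Good` is Mayer–Vietoris**: `Good U → Good V → Good (U ∩ V) → Good (U ∪ V)`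
(`isIso_homologyMap_deRhamMap_union`, `isIso_homologyMap_toSmooth_union`; Bredon (1993),
Lemma V.9.4, property (2)). [cite: Bredon1993, Lemma V.9.4] -/
theorem Good.union {U V : Set M} (hu : Good I U) (hv : Good I V) (huv : Good I (U ∩ V)) : Good I (U ∪ V) := by
  obtain ⟨hU, hu1, hu2⟩ := hu
  obtain ⟨hV, hv1, hv2⟩ := hv
  obtain ⟨hUV, huv1, huv2⟩ := huv
  exact ⟨hU.union hV, fun q ↦ isIso_homologyMap_deRhamMap_union hU hV hu1 hv1 huv1 q,
    fun q ↦ smoothSubsetCochains.isIso_homologyMap_toSmooth_union I ℝ realCoeff hU hV hu2 hv2 huv2 q⟩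

omit [FiniteDimensional ℝ E] [T2Space M] [SecondCountableTopology M] in
/-- **`Good` passes to disjoint unions** (`isIso_homologyMap_deRhamMap_iUnion`,
`isIso_homologyMap_toSmooth_iUnion`; Bredon (1993), property (3)). [cite: Bredon1993, Thm. V.9.5] -/
theorem good_iUnion {U : ℕ → Set M} (hd : Pairwise (Function.onFun Disjoint U)) (h : ∀ i, Good I (U i)) :
    Good I (⋃ i, U i) := by
  have hUo : ∀ i, IsOpen (U i) := fun i ↦ (h i).1
  exact ⟨isOpen_iUnion hUo, fun q ↦ isIso_homologyMap_deRhamMap_iUnion I hUo hd (fun i q ↦ (h i).2.1 q) q,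
    fun q ↦ isIso_homologyMap_toSmooth_iUnion I realCoeff hUo hd (fun i q ↦ (h i).2.2 q) q⟩

end Operations

/-! ### The bootstrap: every open set is good -/

section Bootstrap

variable [I.Boundaryless] [FiniteDimensional ℝ E] [T2Space M] [SecondCountableTopology M] [LocallyCompactSpace M]

/-- The family of chart-convex sets of the chart at `p` (with `C` open convex in the target,
possibly empty) contained in `W`. [folklore] -/
def chartConvexFamily (p : M) (W : Set M) : Set (Set M) :=
  {S | ∃ C : Set E, IsOpen C ∧ Convex ℝ C ∧ C ⊆ (extChartAt I p).target ∧ S = chartSet I p C ∧ S ⊆ W}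

/-- **Level 1 of the bootstrap: an open subset of a chart domain is good** (Bredon (1993), proof
of Thm. V.9.5: "`P(U)` for all open `U ⊆ ℝⁿ`", via the bootstrap lemma applied to convex open
sets of one chart). [cite: Bredon1993, Thm. V.9.5] -/
theorem good_of_subset_source {p : M} {W : Set M} (hW : IsOpen W) (hWs : W ⊆ (extChartAt I p).source) :
    Good I W := by
  obtain ⟨K, hKc, hKint, hKW⟩ := Literature.Topology.exists_compact_exhaustion_of_isOpen hW
  rw [← hKW]
  refine Literature.Topology.open_bootstrap (Good I) (chartConvexFamily (I := I) p W) good_empty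
    (fun U V _ _ hu hv huv ↦ hu.union hv huv) (fun U _ hd h ↦ good_iUnion hd h) ?_ ?_ ?_ hKc hKint ?_
  · rintro S ⟨C, hC, -, -, rfl, -⟩
    exact isOpen_chartSet I p hC
  · rintro S ⟨C, hC, hCc, hCT, rfl, -⟩
    rcases C.eq_empty_or_nonempty with rfl | ⟨c, hc⟩
    · have h0 : chartSet I p (∅ : Set E) = ∅ := by
        ext x; exact ⟨fun h ↦ h.2.elim, fun h ↦ h.elim⟩
      rw [h0]; exact good_empty
    · exact good_chartSet hC hCc hCT hc
  · rintro S ⟨C, hC, hCc, hCT, rfl, hSW⟩ S' ⟨C', hC', hCc', hCT', rfl, -⟩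
    exact ⟨C ∩ C', hC.inter hC', hCc.inter hCc', inter_subset_left.trans hCT, chartSet_inter I p C C',
      inter_subset_left.trans hSW⟩
  · intro O hO hOW x hx
    rw [hKW] at hOW
    have hxs : x ∈ (extChartAt I p).source := hWs (hOW hx)
    -- an open ball around `e x` inside `e.target ∩ e⁻¹ O`
    have hT : IsOpen ((extChartAt I p).target ∩ (extChartAt I p).symm ⁻¹' O) :=
      (continuousOn_extChartAt_symm p).isOpen_inter_preimage (isOpen_extChartAt_target p) hO
    have hxT : extChartAt I p x ∈ (extChartAt I p).target ∩ (extChartAt I p).symm ⁻¹' O :=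
      ⟨(extChartAt I p).map_source hxs, by rw [mem_preimage, (extChartAt I p).left_inv hxs]; exact hx⟩
    obtain ⟨ε, hε, hball⟩ := Metric.isOpen_iff.1 hT _ hxT
    refine ⟨chartSet I p (Metric.ball (extChartAt I p x) ε),
      ⟨_, Metric.isOpen_ball, convex_ball _ _, fun y hy ↦ (hball hy).1, rfl, fun y hy ↦ hOW ?_⟩,
      ⟨hxs, Metric.mem_ball_self hε⟩, fun y hy ↦ ?_⟩ <;>
    · have hy' := hball hy.2
      rw [mem_inter_iff, mem_preimage, (extChartAt I p).left_inv hy.1] at hy'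
      exact hy'.2

/-- **De Rham's theorem on every open set** (the bootstrap, level 2): every open subset of `M` is
good — the de Rham homomorphism and the restriction to smooth chains are isomorphisms on its
cohomology (Bredon (1993), Thm. V.9.5 with the bootstrap lemma of §V.9; Lee (2013), Thm. 18.14).
[cite: Bredon1993, Thm. V.9.5] -/
theorem good_of_isOpen {W : Set M} (hW : IsOpen W) : Good I W := by
  obtain ⟨K, hKc, hKint, hKW⟩ := Literature.Topology.exists_compact_exhaustion_of_isOpen hW
  rw [← hKW]
  refine Literature.Topology.open_bootstrap (Good I)
    {S : Set M | IsOpen S ∧ ∃ p : M, S ⊆ (extChartAt I p).source} good_empty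
    (fun U V _ _ hu hv huv ↦ hu.union hv huv) (fun U _ hd h ↦ good_iUnion hd h) (fun S hS ↦ hS.1)
    (fun S hS ↦ ?_) ?_ hKc hKint ?_
  · obtain ⟨p, hp⟩ := hS.2
    exact good_of_subset_source hS.1 hp
  · rintro S ⟨hS, p, hp⟩ S' ⟨hS', -, -⟩
    exact ⟨hS.inter hS', p, inter_subset_left.trans hp⟩
  · intro O hO _ x hx
    exact ⟨O ∩ (extChartAt I x).source, ⟨hO.inter (isOpen_extChartAt_source x), x, inter_subset_right⟩,
      ⟨hx, mem_extChartAt_source x⟩, inter_subset_left⟩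

/-- **De Rham's theorem for `M`, both comparison maps**: `Good univ`. [cite: Bredon1993, Thm. V.9.5] -/
theorem good_univ : Good I (univ : Set M) :=
  good_of_isOpen isOpen_univ

end Bootstrap

end Literature.Geometry.Manifold
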